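import Literature.MathematicalPhysics.QuantumFieldTheory.Balaban1983to89.B9SupplySockB9P3ZdFrame

/-!
# `Balaban1983to89.B9Eq335PlaquettesOfRegularCubeZd` — [Balaban1985BackgroundPropagators] (3.35) p. 396: ON A CUBE OF THE CLASS (3.35) EVERY PLAQUETTE
# VARIABLE IS CLOSE TO `1` — `‖U(∂p) − 1‖ ≤ exp(4C|η|∕ξ) − 1` for the plaquettes based in the cube (the kinematic half of «(3.35) at a member ⟹ small
# plaquette variables near `Ω₀`», the bridge from the frame's class `bgZd.Reg335` to the hypothesis «plaquettes `α`-close to `1` on a box» of the per-member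
# Theorem 3.11, `B9Thm311PerMemberCubeZd`)

statement-level skeleton of published theorems with citation tags; proofs where landed; nothing here is a claim about the
Yang–Mills mass gap

T. Bałaban, *Propagators for lattice gauge theories in a background field*, Commun. Math. Phys. **99** (1985) 389–434 [`Balaban1985BackgroundPropagators`,
"B9"], journal page = PDF page + 388.  THE PRINT (verbatim, p. 396): *«for an arbitrary cube □ of the described above class, and for a configuration U there
exists a gauge transformation u on □ such that U^u = e^{iηA}, and if the index of □ is j, then |A| < O(1)Mα₀(Lʲη)⁻¹, |∂^ηA| < O(1)Mα₀(Lʲη)⁻² on □ (3.35) …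
The number α₀ characterizes this class of configurations. We will need α₀ so small that O(1)Mα₀ is still a sufficiently small number.»*  [`Balaban1985RegularSpaces`,
"B8"] (1.33) p. 82 pairs (3.35) with «U₀ ∈ 𝔄_k({Ω_j}, α₀)» (small plaquette variables); [`Balaban1985Averaging`, "B7"] (44)–(45) p. 24 (plaquette variables of a
gauge-transformed field: «|V₀(∂p) − 1| = |V(∂p) − 1|»).

CITATION HEADER ∕ WHY THIS FILE (cell `pub-ymgap`, HUMAN RULING D-0062 ∕ D-0149; width seat `pub-ymgap-dag-n06-w3` (g3), node N06 = [B9]; CLAIM-4).  The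
per-member Theorem 3.11 of dag-n06-b g19 (`B9Thm311PerMemberCubeZd.regularAtH_of_pdevOn_lt_cube_of`) concludes at EVERY unitary background whose plaquette
variables are `α`-close to `1` on a box; the junction's binders (`RegularInClassAtH`, `PosDefInClassAtH`, `InvAtH`) are guarded by the frame's class
`bgZd.Reg335` = r05's `B8Eq133Hypotheses.Reg335Zd` at the member's cube class.  The bridge «class (3.35) ⟹ small plaquettes» has a KINEMATIC half (this file:
on ONE cube of the class, every plaquette based in the cube is `exp(4C|η|∕ξ) − 1`-close to `1`, `ξ = Lʲη` the cube's scale, `C` the class constant) and a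
GEOMETRIC half (which plaquettes of the box lie in class cubes — the frame seats', NOT here).  MECHANISM, everything BY NAME: the word of the plaquette
(`B7Prop1Explicit.hol_lplaqWord`), the gauge step `U(∂p) − 1 = u(z)⁻¹(U^u(∂p) − 1)u(z)` (`hol_gaugeAct_closed`, `norm_units_inv_conj_sub_one_le` — only
`u(z)` at the base point enters, and (3.35) bounds it there), `U^u = e^{iηA}` on the cube (`reg335Zd_iff`, `B9Eq39Adjoint.fluct`), and the Banach-algebra
estimate `‖e^{a}e^{b}e^{−c}e^{−e} − 1‖ ≤ e^{‖a‖+‖b‖+‖c‖+‖e‖} − 1` (`Literature.Analysis.Calculus.norm_exp_sub_one_le`).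

WHAT IS PROVED (kernel, 0 sorry, 0 def; no `instance`, no `notation`).
* §1 elementary: `one_add_norm_mul_sub_one_le` (`1 + ‖xy − 1‖ ≤ (1 + ‖x − 1‖)(1 + ‖y − 1‖)`), `one_add_norm_exp_sub_one_le` (`1 + ‖eᵃ − 1‖ ≤ e^{t}` for
  `‖a‖ ≤ t`), ★ `norm_exp4_sub_one_le` (`‖eᵃeᵇeᶜeᵉ − 1‖ ≤ e^{4t} − 1`).
* §2 on `ℤᵈ`: `hol_plaqWord_eq` (the plaquette variable spelled out), ★ `norm_hol_plaqWord_sub_one_le_gaugeAct` (the gauge step at the base point),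
  ★★★ `norm_hol_plaqWord_sub_one_le_of_reg335Zd` — `Reg335Zd η L 𝒬 C U₀`, `(□, j) ∈ 𝒬`, `z, z + e_κ, z + e_μ ∈ □` ⟹ `‖U₀(∂p_{κμ}(z)) − 1‖ ≤
  exp(4|η|C(Lʲη)⁻¹) − 1`; ★★ `norm_hol_plaqWord_sub_one_le_of_reg335Zd'` — the scale-free form `≤ exp(4C) − 1` (`0 < η`, `1 ≤ L`).
* §3 at the junction's frame: ★★ `norm_hol_plaqWord_sub_one_le_of_reg335_bgZd` — `(bgZd 𝔸 L x).Reg335 c α₀ U` ⟹ on every cube of `cubeClass396Zd L x`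
  the plaquettes based in it satisfy `‖U(∂p) − 1‖ ≤ exp(4·c·M·α₀) − 1` («O(1)Mα₀ small ⟹ plaquettes close to 1»); ★★ `…_of_reg335_member` (the binders'
  guard `(bgZd 𝔸 L (memZd M i m)).Reg335 c35 α₀ (ιCfgZd 𝔸 L M i m U₀ hU₀)` verbatim); ★★★ `pdevOn_le_of_reg335_member` — with the COVERAGE of the box by
  class cubes DISPLAYED (`hcov`), `pdevOn lo hi U₀ ≤ exp(4·c₃₅·M·α₀) − 1`: the currency of `B9Thm311PerMemberCubeZd.regularAtH_of_pdevOn_lt_cube_of`.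
* §4 the abstract carrier of [B9] Sect. A (commuting translations `T`, r06's `Reg335Cube` ∕ `Reg335`, [B9]'s `plaqU`): ★★ `norm_plaqU_sub_one_le_of_reg335Cube`,
  `norm_plaqU_sub_one_le_of_reg335`.

HONEST SCOPE.  Lattice kinematics ([folklore] Banach-algebra estimates arranged as the print's sentence «O(1)Mα₀ … sufficiently small»); the crude first-order
bound through `|A|` (the sharper `O(Mα₀η²(Lʲη)⁻²)` through `|∂^ηA|` is not needed by the per-member road and not proved); the COVERAGE of a box by class
cubes is NOT here; no estimate of [B9]'s Theorem 3.3 ∕ 3.11; count-neutral; N05 ∕ N06 NOT discharged; K1⁷ `stmt-QuantumFields-20542` NOT closed; one finite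
`𝕋⁴` programme at fixed `ε`, Bałaban as printed; R4 closes only the conditional finite-`𝕋⁴` rung `BalabanLadder.UV` — nothing continuum ∕ ℝ⁴ ∕ OS ∕ mass
gap ∕ Clay.  Unit `pub-ymgap-dag-n06-w3` (g3), 2026-08-28.
-/

noncomputable section

namespace Literature.MathematicalPhysics.QuantumFieldTheory.Balaban1983to89.B9Eq335PlaquettesOfRegularCubeZd

open NormedSpace
open Complex (I)
open B7Prop1Explicit
open B7Prop2Explicit (unitaryUnits unitaryUnits_le_U1)
open B8Eq133Hypotheses (shiftT byDir byDir_apply Reg335Zd reg335Zd_iff)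
open B9Eq39Adjoint (fluct plaqU)
open B9Eq3117Current (gaugeTr plaqU_gaugeTr)
open B9Eq335RegularityClasses (Reg335Cube Reg335)
open B7Prop1Local (PlaqIn pdevOn)
open B9Eq369Product (val_fluct val_inv_fluct)
open B8LeafModelZd (ZdIdx)
open B9SupplySockB9P3ZdFrame (MemberZd CfgZd bgZd memZd ιCfgZd cubeClass396Zd reg335_bgZd_iff)
open LatticeNorms (scaleLen scaleLen_pos)

-- `Site` alone could resolve to the torus sites of `Setup.lean`; re-export the `ℤ^d` sites of `B7Prop1Explicit`.
export B7Prop1Explicit (Site)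

/-! ## §1  Banach-algebra bookkeeping: `‖eᵃeᵇeᶜeᵉ − 1‖ ≤ e^{4t} − 1` -/

section Elementary

variable {𝔸 : Type*} [NormedRing 𝔸]

/-- `1 + ‖xy − 1‖ ≤ (1 + ‖x − 1‖)(1 + ‖y − 1‖)` (from `xy − 1 = (x − 1)(y − 1) + (x − 1) + (y − 1)`; no hypothesis on the norms). [folklore]
[cite: Balaban1985Averaging, (44)–(45) p.24 (bookkeeping)] -/
theorem one_add_norm_mul_sub_one_le (x y : 𝔸) : 1 + ‖x * y - 1‖ ≤ (1 + ‖x - 1‖) * (1 + ‖y - 1‖) := by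
  have h : x * y - 1 = (x - 1) * (y - 1) + (x - 1) + (y - 1) := by noncomm_ring
  have h1 : ‖x * y - 1‖ ≤ ‖x - 1‖ * ‖y - 1‖ + ‖x - 1‖ + ‖y - 1‖ := by
    rw [h]
    exact (norm_add_le _ _).trans (by gcongr; exact (norm_add_le _ _).trans (by gcongr; exact norm_mul_le _ _))
  nlinarith [h1, norm_nonneg (x - 1), norm_nonneg (y - 1)]

variable [NormedAlgebra ℂ 𝔸] [CompleteSpace 𝔸]

/-- `1 + ‖eᵃ − 1‖ ≤ e^{t}` for `‖a‖ ≤ t` (`‖eᵃ − 1‖ ≤ e^{‖a‖} − 1`, the exponential series past its constant term). [folklore]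
[cite: Balaban1985BackgroundPropagators, (3.35) p.396 (bookkeeping)] -/
theorem one_add_norm_exp_sub_one_le {a : 𝔸} {t : ℝ} (h : ‖a‖ ≤ t) : 1 + ‖exp a - 1‖ ≤ Real.exp t := by
  have h1 := Literature.Analysis.Calculus.norm_exp_sub_one_le a
  have h2 : Real.exp ‖a‖ ≤ Real.exp t := Real.exp_le_exp.mpr h
  linarith

/-- ★ **`‖eᵃeᵇeᶜeᵉ − 1‖ ≤ e^{4t} − 1`** for four exponents of norm `≤ t` (the ordered exponential of a plaquette word). [folklore]
[cite: Balaban1985BackgroundPropagators, (3.1) p.390, (3.35) p.396 (bookkeeping)] -/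
theorem norm_exp4_sub_one_le {a b c e : 𝔸} {t : ℝ} (ha : ‖a‖ ≤ t) (hb : ‖b‖ ≤ t) (hc : ‖c‖ ≤ t) (he : ‖e‖ ≤ t) :
    ‖exp a * exp b * exp c * exp e - 1‖ ≤ Real.exp (4 * t) - 1 := by
  have h0 : ∀ x : 𝔸, 0 ≤ 1 + ‖x - 1‖ := fun x => by positivity
  have hA := one_add_norm_exp_sub_one_le ha
  have hB := one_add_norm_exp_sub_one_le hb
  have hC := one_add_norm_exp_sub_one_le hc
  have hE := one_add_norm_exp_sub_one_le he
  have ht0 : 0 ≤ Real.exp t := (Real.exp_pos t).le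
  have h4 : Real.exp (4 * t) = Real.exp t * Real.exp t * Real.exp t * Real.exp t := by
    rw [show 4 * t = t + t + t + t by ring, Real.exp_add, Real.exp_add, Real.exp_add]
  have key : 1 + ‖exp a * exp b * exp c * exp e - 1‖ ≤ Real.exp t * Real.exp t * Real.exp t * Real.exp t :=
    calc 1 + ‖exp a * exp b * exp c * exp e - 1‖
        ≤ (1 + ‖exp a * exp b * exp c - 1‖) * (1 + ‖exp e - 1‖) := one_add_norm_mul_sub_one_le _ _
      _ ≤ ((1 + ‖exp a * exp b - 1‖) * (1 + ‖exp c - 1‖)) * (1 + ‖exp e - 1‖) :=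
          mul_le_mul_of_nonneg_right (one_add_norm_mul_sub_one_le _ _) (h0 _)
      _ ≤ (((1 + ‖exp a - 1‖) * (1 + ‖exp b - 1‖)) * (1 + ‖exp c - 1‖)) * (1 + ‖exp e - 1‖) :=
          mul_le_mul_of_nonneg_right (mul_le_mul_of_nonneg_right (one_add_norm_mul_sub_one_le _ _) (h0 _)) (h0 _)
      _ ≤ ((Real.exp t * Real.exp t) * Real.exp t) * Real.exp t :=
          mul_le_mul (mul_le_mul (mul_le_mul hA hB (h0 _) ht0) hC (h0 _) (by positivity)) hE (h0 _) (by positivity)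
  linarith

end Elementary

/-! ## §2  On `ℤᵈ`: the plaquettes based in a cube of the class (3.35) -/

section Zd

variable {d : ℕ}

/-- **THE PLAQUETTE VARIABLE SPELLED OUT**: `U(∂p_{κμ}(x)) = U(x, x+e_κ)U(x+e_κ, x+e_κ+e_μ)U(x+e_μ, x+e_μ+e_κ)⁻¹U(x, x+e_μ)⁻¹` (B7 (9) along the word `plaqWord κ μ`;
the same unfolding as the summit-side `Summit.QuantumFields.BalabanUV.Beta.EricePreGauge347Witness.hol_plaqWord_eq`, which a Literature file cannot import, and as
`B9Eq369CurvSmallZd.plaqU_shiftT_byDir` read from the right). [folklore] [cite: Balaban1985Averaging, (9) p.18; Balaban1985BackgroundPropagators, (3.1) p.390] -/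
theorem hol_plaqWord_eq {G : Type*} [Group G] (V : Site d → Fin d → G) (x : Site d) (κ μ : Fin d) :
    hol V x (plaqWord κ μ) = V x κ * V (x + e κ) μ * (V (x + e μ) κ)⁻¹ * (V x μ)⁻¹ := by
  rw [← lplaqWord_true, hol_lplaqWord, stepHol_true, stepHol_true, Letter.vec_true]

variable {𝔸 : Type*} [NormedRing 𝔸] [NormOneClass 𝔸]

/-- ★ **THE GAUGE STEP AT THE BASE POINT** («|V₀(∂p) − 1| = |V(∂p) − 1|», B7 (45)): `U(∂p) − 1 = u(z)⁻¹(U^u(∂p) − 1)u(z)` for a plaquette based at `z`, so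
`‖U(∂p) − 1‖ ≤ ‖U^u(∂p) − 1‖` as soon as `‖u(z)‖, ‖u(z)⁻¹‖ ≤ 1` — only the value of the gauge AT `z` enters.
[cite: Balaban1985Averaging, (45) p.24; Balaban1985BackgroundPropagators, (3.28) p.395] -/
theorem norm_hol_plaqWord_sub_one_le_gaugeAct (U₀ : Site d → Fin d → 𝔸ˣ) {u : Site d → 𝔸ˣ} {z : Site d} (hz : u z ∈ U1 𝔸) (κ μ : Fin d) :
    ‖((hol U₀ z (plaqWord κ μ) : 𝔸ˣ) : 𝔸) - 1‖ ≤ ‖((hol (gaugeAct u U₀) z (plaqWord κ μ) : 𝔸ˣ) : 𝔸) - 1‖ := by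
  have h : hol U₀ z (plaqWord κ μ) = (u z)⁻¹ * hol (gaugeAct u U₀) z (plaqWord κ μ) * u z := by
    rw [hol_gaugeAct_closed u U₀ z _ (disp_plaqWord κ μ)]
    group
  rw [h, Units.val_mul, Units.val_mul]
  exact norm_units_inv_conj_sub_one_le hz _

variable [NormedAlgebra ℂ 𝔸]

omit [NormOneClass 𝔸] in
/-- `‖(iη)·a‖ = |η|‖a‖`. [folklore] [cite: Balaban1985BackgroundPropagators, (3.35) p.396 (bookkeeping)] -/
private theorem norm_I_eta_smul (η : ℝ) (a : 𝔸) : ‖((I * η : ℂ)) • a‖ = |η| * ‖a‖ := by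
  rw [norm_smul, norm_mul, Complex.norm_I, one_mul, Complex.norm_real, Real.norm_eq_abs]

variable [CompleteSpace 𝔸]

/-- ★★★ **ON A CUBE OF THE CLASS (3.35), THE PLAQUETTES BASED IN THE CUBE ARE CLOSE TO `1`**: if `U₀` satisfies «the regularity condition (3.35) in [4]»
(`Reg335Zd η L 𝒬 C U₀`) and `(□, j) ∈ 𝒬`, then for every plaquette `p_{κμ}(z)` with `z, z + e_κ, z + e_μ ∈ □` (the base points of its four bonds),
`‖U₀(∂p) − 1‖ ≤ exp(4|η|·C·(Lʲη)⁻¹) − 1`: gauge to `U₀^u = e^{iηA}` on `□` ((3.35)), read the plaquette as `e^{iηA_κ(z)}e^{iηA_μ(z+e_κ)}e^{−iηA_κ(z+e_μ)}e^{−iηA_μ(z)}`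
with `|A| < C(Lʲη)⁻¹`, and undo the gauge at the base point. [cite: Balaban1985BackgroundPropagators, (3.35) p.396, (3.1) p.390, (3.28) p.395; Balaban1985RegularSpaces, (1.33) p.82; Balaban1985Averaging, (45) p.24] -/
theorem norm_hol_plaqWord_sub_one_le_of_reg335Zd {η : ℝ} {L : ℕ} {𝒬 : Set (Set (Site d) × ℕ)} {C : ℝ} {U₀ : Site d → Fin d → 𝔸ˣ}
    (h : Reg335Zd η L 𝒬 C U₀) {q : Set (Site d) × ℕ} (hq : q ∈ 𝒬) {z : Site d} {κ μ : Fin d}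
    (hz : z ∈ q.1) (hzκ : z + e κ ∈ q.1) (hzμ : z + e μ ∈ q.1) :
    ‖((hol U₀ z (plaqWord κ μ) : 𝔸ˣ) : 𝔸) - 1‖ ≤ Real.exp (4 * (|η| * (C * (scaleLen (L : ℝ) η q.2)⁻¹))) - 1 := by
  obtain ⟨u, A, hu, hrep, hA, -⟩ := (reg335Zd_iff η L 𝒬 C U₀).1 h q hq
  -- the gauge step at the base point `z ∈ □`
  have huz : u z ∈ U1 𝔸 := mem_U1.2 (hu z hz)
  refine (norm_hol_plaqWord_sub_one_le_gaugeAct U₀ huz κ μ).trans ?_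
  -- the four bond variables of `U₀^u` on the plaquette are `e^{iηA}`
  have hb : ∀ (ν : Fin d) (y : Site d), y ∈ q.1 → gaugeAct u U₀ y ν = fluct η A ν y := fun ν y hy => by
    rw [← byDir_apply (gaugeAct u U₀) ν y]
    exact hrep ν y hy
  rw [hol_plaqWord_eq, hb κ z hz, hb μ (z + e κ) hzκ, hb κ (z + e μ) hzμ, hb μ z hz]
  rw [Units.val_mul, Units.val_mul, Units.val_mul, val_fluct, val_fluct, val_inv_fluct, val_inv_fluct]
  -- norms of the exponents
  set t : ℝ := |η| * (C * (scaleLen (L : ℝ) η q.2)⁻¹) with ht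
  have hn : ∀ (ν : Fin d) (y : Site d), y ∈ q.1 → ‖((I * η : ℂ)) • A ν y‖ ≤ t := fun ν y hy => by
    rw [norm_I_eta_smul, ht]
    exact mul_le_mul_of_nonneg_left (hA ν y hy).le (abs_nonneg η)
  have hn' : ∀ (ν : Fin d) (y : Site d), y ∈ q.1 → ‖-(((I * η : ℂ)) • A ν y)‖ ≤ t := fun ν y hy => by
    rw [norm_neg]
    exact hn ν y hy
  exact norm_exp4_sub_one_le (hn κ z hz) (hn μ _ hzκ) (hn' κ _ hzμ) (hn' μ z hz)

/-- ★★ **THE SCALE-FREE FORM** (`0 < η`, `1 ≤ L`): `|η|·C·(Lʲη)⁻¹ = C·L⁻ʲ ≤ C`, so `‖U₀(∂p) − 1‖ ≤ exp(4C) − 1` on every cube of the class, uniformly in the index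
`j` — «O(1)Mα₀ sufficiently small ⟹ plaquette variables close to 1». [cite: Balaban1985BackgroundPropagators, (3.35) p.396 («We will need α₀ so small that O(1)Mα₀ is still a sufficiently small number»); Balaban1985RegularSpaces, (1.33) p.82] -/
theorem norm_hol_plaqWord_sub_one_le_of_reg335Zd' {η : ℝ} (hη : 0 < η) {L : ℕ} (hL : 1 ≤ L) {𝒬 : Set (Set (Site d) × ℕ)} {C : ℝ}
    {U₀ : Site d → Fin d → 𝔸ˣ} (h : Reg335Zd η L 𝒬 C U₀) {q : Set (Site d) × ℕ} (hq : q ∈ 𝒬) {z : Site d} {κ μ : Fin d}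
    (hz : z ∈ q.1) (hzκ : z + e κ ∈ q.1) (hzμ : z + e μ ∈ q.1) :
    ‖((hol U₀ z (plaqWord κ μ) : 𝔸ˣ) : 𝔸) - 1‖ ≤ Real.exp (4 * C) - 1 := by
  refine (norm_hol_plaqWord_sub_one_le_of_reg335Zd h hq hz hzκ hzμ).trans ?_
  -- `0 ≤ C`: the strict bound `‖A‖ < C·ξ⁻¹` at the inhabited cube
  obtain ⟨u, A, -, -, hA, -⟩ := (reg335Zd_iff η L 𝒬 C U₀).1 h q hq
  have hξ : 0 < scaleLen (L : ℝ) η q.2 := scaleLen_pos (by exact_mod_cast hL) hη q.2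
  have hC : 0 ≤ C := by
    have h1 : 0 < C * (scaleLen (L : ℝ) η q.2)⁻¹ := (norm_nonneg _).trans_lt (hA κ z hz)
    exact ((mul_pos_iff_of_pos_right (inv_pos.2 hξ)).1 h1).le
  -- `|η|·C·(Lʲη)⁻¹ = C·L⁻ʲ ≤ C`
  have hLj : 1 ≤ (L : ℝ) ^ q.2 := one_le_pow₀ (by exact_mod_cast hL)
  have key : |η| * (C * (scaleLen (L : ℝ) η q.2)⁻¹) ≤ C := by
    rw [abs_of_pos hη, scaleLen]
    have hcalc : η * (C * ((L : ℝ) ^ q.2 * η)⁻¹) = C / (L : ℝ) ^ q.2 := by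
      field_simp
    rw [hcalc]
    exact div_le_self hC hLj
  have hexp : Real.exp (4 * (|η| * (C * (scaleLen (L : ℝ) η q.2)⁻¹))) ≤ Real.exp (4 * C) :=
    Real.exp_le_exp.2 (by linarith)
  linarith

end Zd

/-! ## §3  At the junction's frame: the class `bgZd.Reg335` of a member -/

section Frame

variable {d : ℕ} {𝔸 : Type} [CStarAlgebra 𝔸] [Nontrivial 𝔸] {L : ℕ}

/-- ★★ **AT THE FRAME `bgZd`**: a configuration `U` of the member `x` in the frame's class (3.35) with constants `(c, α₀)` (r05's `Reg335Zd` at the cube class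
`cubeClass396Zd L x`, constant `c·M·α₀`) has, on every class cube, all plaquettes based in the cube within `exp(4·c·M·α₀) − 1` of `1` (`1 ≤ L`; `η > 0` is the
member's). [cite: Balaban1985BackgroundPropagators, (3.35) p.396; Balaban1985RegularSpaces, (1.33) p.82] -/
theorem norm_hol_plaqWord_sub_one_le_of_reg335_bgZd (hL : 1 ≤ L) (x : MemberZd d L) {c α₀ : ℝ} {U : CfgZd d 𝔸}
    (h : (bgZd 𝔸 L x).Reg335 c α₀ U) {q : Set (Site d) × ℕ} (hq : q ∈ cubeClass396Zd L x) {z : Site d} {κ μ : Fin d}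
    (hz : z ∈ q.1) (hzκ : z + e κ ∈ q.1) (hzμ : z + e μ ∈ q.1) :
    ‖((hol U.1 z (plaqWord κ μ) : 𝔸ˣ) : 𝔸) - 1‖ ≤ Real.exp (4 * (c * x.M * α₀)) - 1 :=
  norm_hol_plaqWord_sub_one_le_of_reg335Zd' x.i.hη hL ((reg335_bgZd_iff x c α₀ U).1 h) hq hz hzκ hzμ

/-- ★★ **IN THE BINDERS' CURRENCY** (`bg := bgZd`, `mem := memZd`, `ιCfg := ιCfgZd` — the guard `(bg (mem M i m)).Reg335 c35 α₀ (ιCfg M i m U₀ hU₀)` of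
`InvAt` ∕ `RegularInClassAtH` ∕ `PosDefInClassAtH` verbatim): on every cube of the member's class, the plaquettes of `U₀` based in the cube are within
`exp(4·c₃₅·M·α₀) − 1` of `1`. [cite: Balaban1985BackgroundPropagators, (3.35) p.396, Thm 3.11 p.416; Balaban1985RegularSpaces, (1.33) p.82] -/
theorem norm_hol_plaqWord_sub_one_le_of_reg335_member (hL : 1 ≤ L) (M : ℝ) (i : ZdIdx d L) (m : ℕ) {c35 α₀ : ℝ}
    {U₀ : Site d → Fin d → 𝔸ˣ} (hU₀ : ∀ x κ, U₀ x κ ∈ unitaryUnits 𝔸)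
    (h : (bgZd 𝔸 L (memZd M i m)).Reg335 c35 α₀ (ιCfgZd 𝔸 L M i m U₀ hU₀)) {q : Set (Site d) × ℕ}
    (hq : q ∈ cubeClass396Zd L (memZd M i m)) {z : Site d} {κ μ : Fin d} (hz : z ∈ q.1) (hzκ : z + e κ ∈ q.1) (hzμ : z + e μ ∈ q.1) :
    ‖((hol U₀ z (plaqWord κ μ) : 𝔸ˣ) : 𝔸) - 1‖ ≤ Real.exp (4 * (c35 * M * α₀)) - 1 :=
  norm_hol_plaqWord_sub_one_le_of_reg335_bgZd hL (memZd M i m) h hq hz hzκ hzμ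

/-- ★★★ **THE BRIDGE TO THE PER-MEMBER THEOREM 3.11, KINEMATIC HALF** — with the COVERAGE of a box by class cubes DISPLAYED as the hypothesis `hcov` (every
plaquette of the box `[lo, hi]` has its three base points in one cube of the member's class; the frame seats' geometric half): the plaquette deviation
`pdevOn lo hi U₀` of `B9Thm311PerMemberCubeZd.regularAtH_of_pdevOn_lt_cube_of` is at most `exp(4·c₃₅·M·α₀) − 1` at every background of the binders' class —
so «`c₃₅·M·α₀` small» (print: «O(1)Mα₀ sufficiently small») puts the class inside the per-member theorem's hypothesis.
[cite: Balaban1985BackgroundPropagators, (3.35) p.396, Thm 3.11 p.416; Balaban1985RegularSpaces, (1.33) p.82, (1.32) p.82] -/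
theorem pdevOn_le_of_reg335_member (hL : 1 ≤ L) (M : ℝ) (i : ZdIdx d L) (m : ℕ) {c35 α₀ : ℝ} (h0 : 0 ≤ c35 * M * α₀)
    {U₀ : Site d → Fin d → 𝔸ˣ} (hU₀ : ∀ x κ, U₀ x κ ∈ unitaryUnits 𝔸)
    (h : (bgZd 𝔸 L (memZd M i m)).Reg335 c35 α₀ (ιCfgZd 𝔸 L M i m U₀ hU₀)) {lo hi : Site d}
    (hcov : ∀ p : Site d × Fin d × Fin d, PlaqIn lo hi p →
      ∃ q ∈ cubeClass396Zd L (memZd M i m), p.1 ∈ q.1 ∧ p.1 + e p.2.1 ∈ q.1 ∧ p.1 + e p.2.2 ∈ q.1) :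
    pdevOn lo hi U₀ ≤ Real.exp (4 * (c35 * M * α₀)) - 1 := by
  refine Real.iSup_le (fun p => ?_) ?_
  · obtain ⟨q, hq, hz, hzκ, hzμ⟩ := hcov p.1 p.2
    exact norm_hol_plaqWord_sub_one_le_of_reg335_member hL M i m hU₀ h hq hz hzκ hzμ
  · have : 1 ≤ Real.exp (4 * (c35 * M * α₀)) := Real.one_le_exp (by positivity)
    linarith

end Frame

/-! ## §4  The abstract carrier of [B9] Sect. A (any lattice `S` with commuting translations `T`) -/

section Abstract

variable {𝔸 : Type*} [NormedRing 𝔸] [NormedAlgebra ℂ 𝔸] [CompleteSpace 𝔸] {S : Type*} {ι : Type*}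
  (T : ι → Equiv.Perm S) {U : ι → S → 𝔸ˣ}

/-- ★★ **(3.35) ON A CUBE ⟹ ITS PLAQUETTES ARE CLOSE TO `1`, AT THE ABSTRACT CARRIER** (r06's `Reg335Cube T U η □ ξ C`, [B9]'s `plaqU`): for `x, T_μx, T_νx ∈ □`,
`‖U(∂p_{μν}(x)) − 1‖ ≤ exp(4|η|Cξ⁻¹) − 1` (commuting translations). [cite: Balaban1985BackgroundPropagators, (3.35) p.396, (3.1) p.390, (3.28) p.395; Balaban1985Averaging, (45) p.24] -/
theorem norm_plaqU_sub_one_le_of_reg335Cube (hT : ∀ μ ν x, T μ (T ν x) = T ν (T μ x)) {η : ℝ} {cube : Set S} {ξ C : ℝ}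
    (h : Reg335Cube T U η cube ξ C) {x : S} {μ ν : ι} (hx : x ∈ cube) (hxμ : T μ x ∈ cube) (hxν : T ν x ∈ cube) :
    ‖(plaqU T U μ ν x : 𝔸) - 1‖ ≤ Real.exp (4 * (|η| * (C * ξ⁻¹))) - 1 := by
  obtain ⟨u, A, hu, hg, hA, -⟩ := h
  -- the gauge step at the base point
  have hconj : plaqU T U μ ν x = (u x)⁻¹ * plaqU T (gaugeTr T u U) μ ν x * u x := by
    rw [plaqU_gaugeTr T U hT u μ ν x]
    group
  have hstep : ‖(plaqU T U μ ν x : 𝔸) - 1‖ ≤ ‖(plaqU T (gaugeTr T u U) μ ν x : 𝔸) - 1‖ := by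
    rw [hconj, Units.val_mul, Units.val_mul]
    exact B7Transfer.norm_conj_sub_one_le _ _ _ (by rw [← Units.val_mul, inv_mul_cancel, Units.val_one]) (hu x hx).2 (hu x hx).1
  refine hstep.trans ?_
  -- the four bond variables of `U^u` on the plaquette are `e^{iηA}`
  rw [plaqU, hg μ x hx, hg ν (T μ x) hxμ, hg μ (T ν x) hxν, hg ν x hx, Units.val_mul, Units.val_mul, Units.val_mul, val_fluct, val_fluct,
    val_inv_fluct, val_inv_fluct]
  have hn : ∀ (κ : ι) (y : S), y ∈ cube → ‖((I * η : ℂ)) • A κ y‖ ≤ |η| * (C * ξ⁻¹) := fun κ y hy => by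
    rw [norm_smul, norm_mul, Complex.norm_I, one_mul, Complex.norm_real, Real.norm_eq_abs]
    exact mul_le_mul_of_nonneg_left (hA κ y hy).le (abs_nonneg η)
  have hn' : ∀ (κ : ι) (y : S), y ∈ cube → ‖-(((I * η : ℂ)) • A κ y)‖ ≤ |η| * (C * ξ⁻¹) := fun κ y hy => by
    rw [norm_neg]
    exact hn κ y hy
  exact norm_exp4_sub_one_le (hn μ x hx) (hn ν _ hxμ) (hn' μ _ hxν) (hn' ν x hx)

/-- ★ the class form: `Reg335 T U η L 𝒬 C`, `(□, j) ∈ 𝒬` ⟹ the plaquettes based in `□` are within `exp(4|η|C(Lʲη)⁻¹) − 1` of `1`.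
[cite: Balaban1985BackgroundPropagators, (3.35) p.396] -/
theorem norm_plaqU_sub_one_le_of_reg335 (hT : ∀ μ ν x, T μ (T ν x) = T ν (T μ x)) {η L : ℝ} {𝒬 : Set (Set S × ℕ)} {C : ℝ}
    (h : Reg335 T U η L 𝒬 C) {q : Set S × ℕ} (hq : q ∈ 𝒬) {x : S} {μ ν : ι} (hx : x ∈ q.1) (hxμ : T μ x ∈ q.1) (hxν : T ν x ∈ q.1) :
    ‖(plaqU T U μ ν x : 𝔸) - 1‖ ≤ Real.exp (4 * (|η| * (C * (scaleLen L η q.2)⁻¹))) - 1 :=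
  norm_plaqU_sub_one_le_of_reg335Cube T hT (h q hq) hx hxμ hxν

end Abstract

end Literature.MathematicalPhysics.QuantumFieldTheory.Balaban1983to89.B9Eq335PlaquettesOfRegularCubeZd

end
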